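import Summits.ResolutionOfSingularities.ResolutionOfSingularities.Theorems.HilbertSamuelEliminationSigmaMaxModificationsCorridor3WLadderIsoRestartSim
import Summits.ResolutionOfSingularities.ResolutionOfSingularities.Theorems.HilbertSamuelEliminationSigmaMaxModificationsCorridor3WLadderIsoRestartBlowup
import Literature.AlgebraicGeometry.Resolution.NormalCrossingsLocal
import HarnessLib

/-!
# [OURS · L1 W4.2] D8-S1 file 6: the ONE-STEP SIMULATION THEOREM of the run-level Zariski localisation (crux chain w42, v7/v8.1 stub
# `stub_isoOpenRestartLocal` ⟸ `LocalRunSimulationM p`; hand res-D-pv-060)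

OURS plumbing (cell `res-hironaka`, slot W4.2, crux `stmt-ResolutionOfSingularities-18506` / conjunct `-19249`; `--supports … --as helper`,
counted 0); NOT statements of the manuscript under review [claim: Hironaka2017, status: under-review] nor of [CossartJannsenSaito2020] (POINTER:
Thm. 1.2, Rem. 6.29 (1)). AI plumbing, weaker than expert review.

`SimRel.step`: along a canonical near step `s → s'` of the global run (functional, admissible, LOCAL oracle; `ν ≠ Φ^{(N)}`; cycle invariant
at `s`), a simulation state over `s` is carried to one over `s'`, the open either IDLING (`SimRel.idle`: the canonical centre misses the open,
`ι` lifts into the blow-up, labels by `LabelRel.next_left`) or taking its own CANONICAL NEAR STEP with centre `ι^* C` (`SimRel.ustep`: along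
`Bl(ι)`, labels by `LabelRel.next_next`, cycle invariant by `CycleInv.step`), and genuinely whenever the global step is genuine at the marked
point. The eleven leaves of the case table (D8-S1 DESIGN §5): cycle start missing the open (idle; (a)/(b)), cycle start meeting the open
(start-and-end / start-replay / invisible first centre ⇒ (a)/(d)/(c)), irrelevant cycle (idle; (b)/(a)), relevant not-started cycle (end ⇒
start-and-end; replay visible ⇒ (d); invisible ⇒ (c)), both inside (end ⇒ end; replay visible ⇒ (d); invisible ⇒ (d)) — visibility of a
replay centre `D` = its restriction to the open piece is not the unit ideal (push–pull, file 3), cycle ends ALWAYS replayed on the open,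
pending sequences by the prune algebra (file 4) and blow-up uniqueness off the centre. [folklore]
-/

noncomputable section

set_option linter.dupNamespace false -- mandated namespace of this single-conjunct summit

open CategoryTheory CategoryTheory.Limits AlgebraicGeometry TopologicalSpace
open Summit.ResolutionOfSingularities.ResolutionOfSingularities.Theorems.CampaignW42
open Literature.AlgebraicGeometry.Resolution Literature.RingTheory.HilbertSamuel
open Literature.AlgebraicGeometry.CossartJannsenSaito2020
open Summit.ResolutionOfSingularities.ResolutionOfSingularities.Theorems.SigmaMaxModificationsCorridor3
open Summit.ResolutionOfSingularities.ResolutionOfSingularities.Theorems.SigmaMaxModificationsCorridor3.Moving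
open Summit.ResolutionOfSingularities.ResolutionOfSingularities.Theorems.SigmaMaxModificationsCorridor3.Helpers (QPointed)

universe u

namespace Summit.ResolutionOfSingularities.ResolutionOfSingularities.Cruxes.SigmaMaxModifications.IdeasL1Idea2R4

variable {R : ∀ S : Scheme.{u}, CentreSeq S → Prop} {N : ℕ} {ν : ℕ → ℕ}

/-! ## §2. The two constructors of the next simulation state: IDLE (the open is not blown up) and STEP (the open is blown up) -/

section Constructors

variable {k k' : Type u} [Field k] [Field k'] {s u : MarkedStage.{u}} {ι : u.W ⟶ s.W}

/-- **IDLE STEP ON THE OPEN.** If the canonical centre `C` of the global step misses the range of `ι`, the open is carried unchanged into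
the next global stage along the lift `ι' : u.W ⟶ Bl_C(s.W)` of `ι`; labels stay related (`LabelRel.next_left`), and the marked point of `s`
is NOT blown up. The new pending relation is supplied by the caller (it depends on the case). [cite: CossartJannsenSaito2020, Rem. 6.29 (1)] -/
theorem SimRel.idle (hRf : OracleFunctional R) (hs : CycleInv k R N ν s) (h : SimRel k' R N ν s u ι)
    {C : s.W.IdealSheafData} {P' : Option (Pending (blowup C))} (hln : IsLocallyNoetherian (blowup C)) {x' : ↥(blowup C)}
    (hcs : IsCanonicalStep R N ν s.L s.P C P') (hπ : (blowup.π C).base x' = s.pt)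
    (hdisj : Disjoint (Set.range ι.base) (C.support : Set s.W))
    (hpend : ∀ ι' : u.W ⟶ blowup C, IsOpenImmersion ι' → ι' ≫ blowup.π C = ι →
      Set.range ι'.base = (blowup.π C).base ⁻¹' Set.range ι.base → PendRel R N ν ι' u.L P' u.P) :
    ∃ ι' : u.W ⟶ blowup C,
      SimRel k' R N ν ⟨blowup C, hln, s.L.next (Scheme.hsStratum s.W N ν) C, P', x'⟩ u ι' ∧
        (s.IsBlownUp R N ν → CanonicalNearStep R N ν u u ∧ u.IsBlownUp R N ν) := by
  haveI := h.isOpenImmersion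
  haveI : IsLocallyNoetherian s.W := s.ln
  haveI : IsLocallyNoetherian u.W := u.ln
  haveI : IsLocallyNoetherian (blowup C) := hln
  obtain ⟨ι', hι'o, hι'π, hrange⟩ := exists_lift_off_centre ι C hdisj
  haveI := hι'o
  have hsq : ∀ y, (blowup.π C).base (ι'.base y) = ι.base y := fun y => by
    rw [← Scheme.Hom.comp_apply, hι'π]
  refine ⟨ι', ⟨hι'o, ?_, h.cycleInv, ?_, hpend ι' hι'o hι'π hrange⟩, ?_⟩
  · -- the marked point: `x'` lies over the range of `ι`, hence in the range of `ι'`, and `π` is injective there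
    show ι'.base u.pt = x'
    have hx'r : x' ∈ Set.range ι'.base := by
      rw [hrange, Set.mem_preimage, hπ, ← h.base_pt]
      exact ⟨u.pt, rfl⟩
    obtain ⟨y, rfl⟩ := hx'r
    congr 1
    apply ι.isOpenEmbedding.injective
    rw [← hsq y, hπ, h.base_pt]
  · -- labels: every new component over the open dominates
    show LabelRel ι' (Scheme.hsStratum (blowup C) N ν) (s.L.next (Scheme.hsStratum s.W N ν) C) u.L
    refine h.labelRel.next_left hs.isClosed_hsStratum C ι' hι'π ?_
    rw [Scheme.preimage_hsStratum_of_isOpenImmersion ι' N ν, Scheme.preimage_hsStratum_of_isOpenImmersion ι N ν]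
  · -- the marked point of `s` is not blown up: the canonical centre misses `s.pt = ι u.pt`
    rintro ⟨C₂, P₂, hcs₂, hpt⟩
    obtain rfl : C = C₂ := hcs.centre_unique hRf hcs₂
    exact absurd (Set.disjoint_left.mp hdisj ⟨u.pt, h.base_pt⟩) (not_not.mpr hpt)

/-- **GENUINE STEP ON THE OPEN.** If the open takes its canonical step with centre `ι^* C` (the caller supplies the canonical-step
witness on the open side and the new pending relation along `Bl(ι)`), the next states are related along
`Bl(ι) : Bl_{ι^*C}(u.W) ⟶ Bl_C(s.W)` (marked point = the point over `x'`; labels by `LabelRel.next_next`; cycle invariant by `CycleInv.step`),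
the open's step is a canonical near step, and it is genuine at the marked point as soon as the global one is.
[cite: CossartJannsenSaito2020, Rem. 6.29 (1)] -/
theorem SimRel.ustep (hRa : OracleAdmissible R) (hν : ν ≠ iterPSum N Phi) (hs : CycleInv k R N ν s) (h : SimRel k' R N ν s u ι)
    {C : s.W.IdealSheafData} {P' : Option (Pending (blowup C))} (hln : IsLocallyNoetherian (blowup C)) {x' : ↥(blowup C)}
    (hπ : (blowup.π C).base x' = s.pt) (hclx : IsClosed ({x'} : Set ↥(blowup C)))
    (hx'Y : x' ∈ Scheme.hsStratum (blowup C) N ν) {PU' : Option (Pending (blowup (C.comap ι)))}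
    (hcsU : IsCanonicalStep R N ν u.L u.P (C.comap ι) PU')
    (hpend : haveI := h.isOpenImmersion
      PendRel R N ν (blowup.map C ι) (u.L.next (Scheme.hsStratum u.W N ν) (C.comap ι)) P' PU') :
    ∃ (u' : MarkedStage.{u}) (ι' : u'.W ⟶ blowup C),
      SimRel k' R N ν ⟨blowup C, hln, s.L.next (Scheme.hsStratum s.W N ν) C, P', x'⟩ u' ι' ∧
        CanonicalNearStep R N ν u u' ∧ (s.pt ∈ (C.support : Set s.W) → u.IsBlownUp R N ν) := by
  haveI := h.isOpenImmersion
  haveI : IsLocallyNoetherian s.W := s.ln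
  haveI : IsLocallyNoetherian u.W := u.ln
  haveI : IsLocallyNoetherian (blowup C) := hln
  haveI : IsLocallyNoetherian (blowup (C.comap ι)) := isLocallyNoetherian_of_isOpenImmersion (blowup.map C ι)
  have hsq : ∀ y, (blowup.π C).base ((blowup.map C ι).base y) = ι.base ((blowup.π (C.comap ι)).base y) := fun y => by
    rw [← Scheme.Hom.comp_apply, blowup.map_π, Scheme.Hom.comp_apply]
  -- the marked point upstairs: the point of `Bl_{ι^*C}(u.W)` over `x'`
  have hx'r : (blowup.π C).base x' ∈ Set.range ι.base := ⟨u.pt, by rw [h.base_pt, hπ]⟩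
  obtain ⟨xU, hxU⟩ := exists_blowupMap_eq C ι hx'r
  have hπU : (blowup.π (C.comap ι)).base xU = u.pt := by
    apply ι.isOpenEmbedding.injective
    rw [← hsq xU, hxU, hπ, h.base_pt]
  have hclU : IsClosed ({xU} : Set ↥(blowup (C.comap ι))) := by
    have : ({xU} : Set ↥(blowup (C.comap ι))) = (blowup.map C ι).base ⁻¹' {x'} := by
      ext z
      simp only [Set.mem_singleton_iff, Set.mem_preimage]
      rw [← hxU]
      exact ((blowup.map C ι).isOpenEmbedding.injective.eq_iff).symm
    rw [this]
    exact hclx.preimage (blowup.map C ι).continuous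
  have hxUY : xU ∈ Scheme.hsStratum (blowup (C.comap ι)) N ν := by
    rw [← Scheme.preimage_hsStratum_of_isOpenImmersion (blowup.map C ι) N ν, Set.mem_preimage, hxU]
    exact hx'Y
  let u' : MarkedStage.{u} := ⟨blowup (C.comap ι), inferInstance, u.L.next (Scheme.hsStratum u.W N ν) (C.comap ι), PU', xU⟩
  have hstepU : CanonicalNearStep R N ν u u' := ⟨C.comap ι, PU', inferInstance, xU, hcsU, hπU, hclU, hxUY, rfl⟩
  refine ⟨u', blowup.map C ι, ⟨inferInstance, hxU, h.cycleInv.step hRa hν hstepU, ?_, hpend⟩, hstepU, ?_⟩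
  · -- labels
    show LabelRel (blowup.map C ι) (Scheme.hsStratum (blowup C) N ν) (s.L.next (Scheme.hsStratum s.W N ν) C)
      (u.L.next (Scheme.hsStratum u.W N ν) (C.comap ι))
    have := h.labelRel.next_next hs.isClosed_hsStratum hs.label_le_year h.cycleInv.label_le_year C (C.comap ι)
      (blowup.map C ι) (blowup.map_π C ι) (range_blowupMap C ι) (Scheme.hsStratum (blowup C) N ν)
    rwa [Scheme.preimage_hsStratum_of_isOpenImmersion ι N ν] at this
  · intro hpt
    refine ⟨C.comap ι, PU', hcsU, ?_⟩
    rw [Scheme.IdealSheafData.support_comap]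
    show ι.base u.pt ∈ (C.support : Set s.W)
    rw [h.base_pt]
    exact hpt

end Constructors

/-! ## §3. The one-step theorem -/

section Step

variable {k k' : Type u} [Field k] [Field k'] {s s' u : MarkedStage.{u}} {ι : u.W ⟶ s.W}

/-- **THE ONE-STEP SIMULATION THEOREM.** Along a canonical near step `s → s'` of the global run (functional, admissible, LOCAL oracle;
`ν ≠ Φ^{(N)}`; cycle invariant at `s`; `s.pt` in the stratum), a simulation state `(u, ι)` over `s` is carried to a simulation state
`(u', ι')` over `s'`, where EITHER the open is idle (`u' = u`) OR the open takes a canonical near step `u → u'`; and if the global step is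
genuine at the marked point then the open steps, genuinely at its marked point. Case table: D8-S1 DESIGN §5/§6 (cycle start missing /
meeting the open; replay centres visible iff their restriction to the replayed open piece is not the unit ideal; cycle ends always
replayed on the open). [cite: CossartJannsenSaito2020, Rem. 6.29 (1), Thm. 1.2] -/
theorem SimRel.step (hRf : OracleFunctional R) (hRa : OracleAdmissible R) (hRl : OracleLocal R) (hν : ν ≠ iterPSum N Phi)
    (hs : CycleInv k R N ν s) (hspt : s.pt ∈ Scheme.hsStratum s.W N ν) (h : SimRel k' R N ν s u ι)
    (hst : CanonicalNearStep R N ν s s') :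
    ∃ (u' : MarkedStage.{u}) (ι' : u'.W ⟶ s'.W), SimRel k' R N ν s' u' ι' ∧ (u' = u ∨ CanonicalNearStep R N ν u u') ∧
      (s.IsBlownUp R N ν → CanonicalNearStep R N ν u u' ∧ u.IsBlownUp R N ν) := by
  haveI := h.isOpenImmersion
  haveI : IsLocallyNoetherian s.W := s.ln
  haveI : IsLocallyNoetherian u.W := u.ln
  haveI : IsNoetherian u.W := h.cycleInv.isNoetherian
  obtain ⟨C, P', hln, x', hcs, hπ, hclx, hx'Y, rfl⟩ := hst
  haveI : IsLocallyNoetherian (blowup C) := hln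
  -- bookkeeping shared by all cases
  have hYs : IsClosed (Scheme.hsStratum s.W N ν) := hs.isClosed_hsStratum
  have hYu : ι.base ⁻¹' Scheme.hsStratum s.W N ν = Scheme.hsStratum u.W N ν := Scheme.preimage_hsStratum_of_isOpenImmersion ι N ν
  have hupt : u.pt ∈ Scheme.hsStratum u.W N ν := by rw [← hYu, Set.mem_preimage, h.base_pt]; exact hspt
  have hblown : s.IsBlownUp R N ν → s.pt ∈ (C.support : Set s.W) := by
    rintro ⟨C₂, P₂, hcs₂, hpt⟩
    obtain rfl : C = C₂ := hcs.centre_unique hRf hcs₂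
    exact hpt
  -- packaging of the two outcomes
  have finish_idle : (∃ ι' : u.W ⟶ blowup C,
      SimRel k' R N ν ⟨blowup C, hln, s.L.next (Scheme.hsStratum s.W N ν) C, P', x'⟩ u ι' ∧
        (s.IsBlownUp R N ν → CanonicalNearStep R N ν u u ∧ u.IsBlownUp R N ν)) →
      ∃ (u' : MarkedStage.{u}) (ι' : u'.W ⟶ blowup C),
        SimRel k' R N ν ⟨blowup C, hln, s.L.next (Scheme.hsStratum s.W N ν) C, P', x'⟩ u' ι' ∧
        (u' = u ∨ CanonicalNearStep R N ν u u') ∧ (s.IsBlownUp R N ν → CanonicalNearStep R N ν u u' ∧ u.IsBlownUp R N ν) :=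
    fun ⟨ι', hh⟩ => ⟨u, ι', hh.1, Or.inl rfl, hh.2⟩
  have finish_step : (∃ (u' : MarkedStage.{u}) (ι' : u'.W ⟶ blowup C),
      SimRel k' R N ν ⟨blowup C, hln, s.L.next (Scheme.hsStratum s.W N ν) C, P', x'⟩ u' ι' ∧
        CanonicalNearStep R N ν u u' ∧ (s.pt ∈ (C.support : Set s.W) → u.IsBlownUp R N ν)) →
      ∃ (u' : MarkedStage.{u}) (ι' : u'.W ⟶ blowup C),
        SimRel k' R N ν ⟨blowup C, hln, s.L.next (Scheme.hsStratum s.W N ν) C, P', x'⟩ u' ι' ∧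
        (u' = u ∨ CanonicalNearStep R N ν u u') ∧ (s.IsBlownUp R N ν → CanonicalNearStep R N ν u u' ∧ u.IsBlownUp R N ν) :=
    fun ⟨u', ι', hh⟩ => ⟨u', ι', hh.1, Or.inr hh.2.1, fun hb => ⟨hh.2.1, hh.2.2 (hblown hb)⟩⟩
  have hpend := h.pendRel
  have hcs₀ := hcs
  rcases hsP : s.P with _ | P
  · ----------------------------------------------------------------------------------------------------------------
    -- (A) the global run STARTS a cycle on the least non-empty label part `T = Y^{(j)}`
    rw [hsP] at hcs hpend
    obtain ⟨j, hj, hcl, t, hRt, hrs⟩ := hcs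
    -- the open is between cycles too
    have huP : u.P = none := by
      rcases huP : u.P with _ | Q
      · rfl
      · rw [huP] at hpend; exact (not_pendRel_none_some ι u.L Q hpend).elim
    have hrangeI : Set.range (Scheme.IdealSheafData.vanishingIdeal
        (⟨s.L.part (Scheme.hsStratum s.W N ν) j, hcl⟩ : Closeds s.W)).subschemeι.base = s.L.part (Scheme.hsStratum s.W N ν) j := by
      rw [Scheme.IdealSheafData.range_subschemeι, Scheme.IdealSheafData.coe_support_vanishingIdeal]
      rfl
    by_cases hdj : Disjoint (Set.range ι.base) (s.L.part (Scheme.hsStratum s.W N ν) j)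
    · -- (A1) the new cycle MISSES the open: the open idles
      cases t with
      | nil _ =>
        obtain ⟨⟨hcl', rfl⟩, rfl⟩ := hrs
        refine finish_idle (h.idle hRf hs hln hcs₀ hπ ?_ fun ι' _ _ _ => ?_)
        · rw [Scheme.IdealSheafData.coe_support_vanishingIdeal]; exact hdj
        · rw [huP]; exact pendRel_none_none _ _
      | cons D t₁ =>
        obtain ⟨rfl, φ', hφ', hφ'π, rfl⟩ := hrs
        refine finish_idle (h.idle hRf hs hln hcs₀ hπ ?_ fun ι' hι'o hι'π hrange' => ?_)
        · exact hdj.mono_right ((support_map_subset_range _ D).trans hrangeI.le)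
        · rw [huP]
          refine Or.inl (disjoint_of_subset_preimage (range_subset_preimage_of_comp_eq hφ'π) hrange' ?_)
          rw [hrangeI]; exact hdj.symm
    · -- (A2) the new cycle MEETS the open: the least non-empty label of the open is the trace of `T`
      obtain ⟨w, hwι, hwT⟩ := Set.not_disjoint_iff.mp hdj
      obtain ⟨Z₀, hZ₀, hl₀, hwZ₀⟩ := (s.L.mem_part_iff _ j w).mp hwT
      have hne₀ : (Z₀ ∩ Set.range ι.base).Nonempty := ⟨w, hwZ₀, hwι⟩
      obtain ⟨jU, hjUdef⟩ : ∃ jU, u.L.label (ι.base ⁻¹' Z₀) = jU := ⟨_, rfl⟩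
      have hjU : IsLeast {i | (u.L.part (Scheme.hsStratum u.W N ν) i).Nonempty} jU := by
        have := h.labelRel.isLeast hj hZ₀ hl₀ hne₀
        rwa [hYu, hjUdef] at this
      have hTU : ι.base ⁻¹' s.L.part (Scheme.hsStratum s.W N ν) j = u.L.part (Scheme.hsStratum u.W N ν) jU := by
        have := h.labelRel.preimage_part_eq hZ₀ hne₀
        rwa [hl₀, hYu, hjUdef] at this
      have hclU : IsClosed (u.L.part (Scheme.hsStratum u.W N ν) jU) := hTU ▸ hcl.preimage ι.continuous
      have hJI : Scheme.IdealSheafData.vanishingIdeal (⟨u.L.part (Scheme.hsStratum u.W N ν) jU, hclU⟩ : Closeds u.W) =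
          (Scheme.IdealSheafData.vanishingIdeal (⟨s.L.part (Scheme.hsStratum s.W N ν) j, hcl⟩ : Closeds s.W)).comap ι := by
        rw [comap_vanishingIdeal_of_isOpenImmersion ι]
        congr 1
        ext1
        exact hTU.symm
      obtain ⟨jT, hjTo, HT⟩ := exists_subschemeMap_of_comap ι _ _ hJI
      haveI := hjTo
      have hRU : R _ ((t.comap jT).prune) := by
        have := hRl jT t hRt
        rwa [CentreSeq.restrict_eq_comap] at this
      cases t with
      | nil _ =>
        obtain ⟨⟨hcl', rfl⟩, rfl⟩ := hrs
        -- the open starts AND ends its cycle: centre `ι^* 𝓘_T = 𝓘_{T_U}`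
        refine finish_step (h.ustep hRa hν hs hln hπ hclx hx'Y (PU' := none) ?_ (pendRel_none_none _ _))
        rw [huP]
        exact ⟨jU, hjU, hclU, CentreSeq.nil _, by simpa using hRU, ⟨hclU, hJI.symm⟩, rfl⟩
      | cons D t₁ =>
        obtain ⟨rfl, φ', hφ', hφ'π, rfl⟩ := hrs
        haveI := hφ'
        by_cases hD : D.comap jT = ⊤
        · -- the first centre is invisible on the open: the open idles in state (c)
          have hdisj := (comap_eq_top_iff_disjoint_support_map HT D).mp hD
          refine finish_idle (h.idle hRf hs hln hcs₀ hπ hdisj fun ι' hι'o hι'π hrange' => ?_)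
          haveI := hι'o
          rw [huP]
          obtain ⟨jP', hjP'o, hjP'π, HP'⟩ := exists_lift_src_off_centre HT hφ'π hD ι' hι'π hrange'
          refine Or.inr ⟨jU, hclU, jP', hjU, hjP'o, HP', ?_⟩
          rw [← prune_comap_cons_eq_of_lift D t₁ hD hjP'π]
          exact hRU
        · -- the first centre is visible: the open starts its cycle, replaying the restricted centre; state (d)
          obtain ⟨ψ', hψ', hψ'π, Hsq⟩ := exists_pushforwardMap_restrict (ψ := φ') HT hφ'π
          refine finish_step (h.ustep hRa hν hs hln hπ hclx hx'Y
            (PU' := some ⟨jU, blowup (D.comap jT), ψ', hψ', (t₁.comap (blowup.map D jT)).prune⟩) ?_ ?_)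
          · rw [huP]
            refine ⟨jU, hjU, hclU, CentreSeq.cons (D.comap jT) (t₁.comap (blowup.map D jT)).prune, ?_, ?_⟩
            · rw [prune_comap_cons_of_ne_top D t₁ jT hD] at hRU; exact hRU
            · exact ⟨comap_map_eq_map_comap_of_isPullback HT D, ψ', hψ', hψ'π, rfl⟩
          · exact ⟨blowup.map D jT, inferInstance, Hsq, rfl⟩
  · ----------------------------------------------------------------------------------------------------------------
    -- (B) the global run is INSIDE a cycle
    rw [hsP] at hcs hpend
    haveI := P.isClosedImmersion
    obtain ⟨-, hrs⟩ := hcs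
    obtain ⟨hrangeP, -, -, -⟩ := hs.pending P hsP
    rcases huP : u.P with _ | Q
    · rw [huP] at hpend
      rcases hpend with hdisjP | ⟨jU, hclU, jP, hjU, hjPo, HP, hRU⟩
      · -- (b) the cycle is irrelevant for the open: every step of it is idle on the open
        rcases hr : P.rest with _ | ⟨D, t⟩
        · rw [hr] at hrs
          obtain ⟨⟨hcl', rfl⟩, rfl⟩ := hrs
          refine finish_idle (h.idle hRf hs hln hcs₀ hπ ?_ fun ι' _ _ _ => ?_)
          · rw [Scheme.IdealSheafData.coe_support_vanishingIdeal]
            show Disjoint (Set.range ι.base) (s.L.part (Scheme.hsStratum s.W N ν) P.lbl)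
            rw [← hrangeP]; exact hdisjP.symm
          · rw [huP]; exact pendRel_none_none _ _
        · rw [hr] at hrs
          obtain ⟨rfl, φ', hφ', hφ'π, rfl⟩ := hrs
          refine finish_idle (h.idle hRf hs hln hcs₀ hπ ?_ fun ι' hι'o hι'π hrange' => ?_)
          · exact hdisjP.symm.mono_right (support_map_subset_range P.hom D)
          · rw [huP]
            exact Or.inl (disjoint_of_subset_preimage (range_subset_preimage_of_comp_eq hφ'π) hrange' hdisjP)
      · -- (c) the cycle is relevant, not yet started on the open
        haveI := hjPo
        have hTU : ι.base ⁻¹' s.L.part (Scheme.hsStratum s.W N ν) P.lbl = u.L.part (Scheme.hsStratum u.W N ν) jU := by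
          rw [← hrangeP, ← range_snd_eq_preimage_range_of_isPullback HP, Scheme.IdealSheafData.range_subschemeι,
            Scheme.IdealSheafData.coe_support_vanishingIdeal]
          rfl
        rcases hr : P.rest with _ | ⟨D, t⟩
        · rw [hr] at hrs hRU
          obtain ⟨⟨hcl', rfl⟩, rfl⟩ := hrs
          -- the open starts AND ends its cycle
          refine finish_step (h.ustep hRa hν hs hln hπ hclx hx'Y (PU' := none) ?_ (pendRel_none_none _ _))
          rw [huP]
          refine ⟨jU, hjU, hclU, CentreSeq.nil _, by simpa using hRU, ⟨hclU, ?_⟩, rfl⟩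
          rw [comap_vanishingIdeal_of_isOpenImmersion ι]
          congr 1
          ext1
          exact hTU
        · rw [hr] at hrs hRU
          obtain ⟨rfl, φ', hφ', hφ'π, rfl⟩ := hrs
          haveI := hφ'
          by_cases hD : D.comap jP = ⊤
          · -- invisible replay centre: idle, stay in (c)
            have hdisj := (comap_eq_top_iff_disjoint_support_map HP D).mp hD
            refine finish_idle (h.idle hRf hs hln hcs₀ hπ hdisj fun ι' hι'o hι'π hrange' => ?_)
            haveI := hι'o
            rw [huP]
            obtain ⟨jP', hjP'o, hjP'π, HP'⟩ := exists_lift_src_off_centre HP hφ'π hD ι' hι'π hrange'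
            refine Or.inr ⟨jU, hclU, jP', hjU, hjP'o, HP', ?_⟩
            rw [← prune_comap_cons_eq_of_lift D t hD hjP'π]
            exact hRU
          · -- visible replay centre: the open starts its cycle by replaying it; state (d)
            obtain ⟨ψ', hψ', hψ'π, Hsq⟩ := exists_pushforwardMap_restrict (ψ := φ') HP hφ'π
            refine finish_step (h.ustep hRa hν hs hln hπ hclx hx'Y
              (PU' := some ⟨jU, blowup (D.comap jP), ψ', hψ', (t.comap (blowup.map D jP)).prune⟩) ?_ ?_)
            · rw [huP]
              refine ⟨jU, hjU, hclU, CentreSeq.cons (D.comap jP) (t.comap (blowup.map D jP)).prune, ?_, ?_⟩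
              · rw [prune_comap_cons_of_ne_top D t jP hD] at hRU; exact hRU
              · exact ⟨comap_map_eq_map_comap_of_isPullback HP D, ψ', hψ', hψ'π, rfl⟩
            · exact ⟨blowup.map D jP, inferInstance, Hsq, rfl⟩
    · -- (d) both runs inside the cycle
      rw [huP] at hpend
      obtain ⟨jP, hjPo, HP, hrest⟩ := hpend
      haveI := Q.isClosedImmersion
      haveI := hjPo
      obtain ⟨hrangeQ, -, -, -⟩ := h.cycleInv.pending Q huP
      have hclQ : IsClosed (u.L.part (Scheme.hsStratum u.W N ν) Q.lbl) :=
        hrangeQ ▸ Q.hom.isClosedEmbedding.isClosed_range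
      have hTU : ι.base ⁻¹' s.L.part (Scheme.hsStratum s.W N ν) P.lbl = u.L.part (Scheme.hsStratum u.W N ν) Q.lbl := by
        rw [← hrangeP, ← hrangeQ]
        exact (range_snd_eq_preimage_range_of_isPullback HP).symm
      rcases hr : P.rest with _ | ⟨D, t⟩
      · rw [hr] at hrs hrest
        obtain ⟨⟨hcl', rfl⟩, rfl⟩ := hrs
        have hrest' : Q.rest = CentreSeq.nil _ := by simpa using hrest
        -- the open ends its cycle too
        refine finish_step (h.ustep hRa hν hs hln hπ hclx hx'Y (PU' := none) ?_ (pendRel_none_none _ _))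
        rw [huP]
        refine ⟨⟨u.pt, hupt⟩, ?_⟩
        show IsReplayStep u.L (Scheme.hsStratum u.W N ν) Q.lbl Q.hom Q.rest _ none
        rw [hrest']
        refine ⟨⟨hclQ, ?_⟩, rfl⟩
        rw [comap_vanishingIdeal_of_isOpenImmersion ι]
        congr 1
        ext1
        exact hTU
      · rw [hr] at hrs hrest
        obtain ⟨rfl, φ', hφ', hφ'π, rfl⟩ := hrs
        haveI := hφ'
        by_cases hD : D.comap jP = ⊤
        · -- invisible replay centre: idle, stay in (d)
          have hdisj := (comap_eq_top_iff_disjoint_support_map HP D).mp hD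
          refine finish_idle (h.idle hRf hs hln hcs₀ hπ hdisj fun ι' hι'o hι'π hrange' => ?_)
          haveI := hι'o
          rw [huP]
          obtain ⟨jP', hjP'o, hjP'π, HP'⟩ := exists_lift_src_off_centre HP hφ'π hD ι' hι'π hrange'
          refine ⟨jP', hjP'o, HP', ?_⟩
          rw [hrest]
          exact prune_comap_cons_eq_of_lift D t hD hjP'π
        · -- visible replay centre: the open replays it too; stay in (d)
          obtain ⟨ψ', hψ', hψ'π, Hsq⟩ := exists_pushforwardMap_restrict (ψ := φ') HP hφ'π
          refine finish_step (h.ustep hRa hν hs hln hπ hclx hx'Y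
            (PU' := some ⟨Q.lbl, blowup (D.comap jP), ψ', hψ', (t.comap (blowup.map D jP)).prune⟩) ?_ ?_)
          · rw [huP]
            refine ⟨⟨u.pt, hupt⟩, ?_⟩
            show IsReplayStep u.L (Scheme.hsStratum u.W N ν) Q.lbl Q.hom Q.rest _ _
            rw [hrest, prune_comap_cons_of_ne_top D t jP hD]
            exact ⟨comap_map_eq_map_comap_of_isPullback HP D, ψ', hψ', hψ'π, rfl⟩
          · exact ⟨blowup.map D jP, inferInstance, Hsq, rfl⟩

end Step


end Summit.ResolutionOfSingularities.ResolutionOfSingularities.Cruxes.SigmaMaxModifications.IdeasL1Idea2R4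

end
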